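import Summits.HodgeConjecture.CorCM.OcticWeilMixedPowersHodgeOfMarkman
import Summits.HodgeConjecture.CorCM.OcticWeilOrbitHodgeOfMarkman
import Summits.HodgeConjecture.CorCM.OcticCurveFourfoldHodgeOfMarkman
import Summits.HodgeConjecture.CorCM.CyclicSexticInducedType
import HarnessLib

/-!
# COR-CM — the Hodge conjecture for every product of copies of `E`, two Galois-conjugate DEGENERATE simple CM fourfolds
# `B₁, B₂` (`(2,2)`-types in general position) and ANY CM fourfold `B'` of `k`-signature `(1,3)` with CM by the same octic
# field, GIVEN ONLY Markman's fourfold and hyperbolic-sixfold theorems: the INTRINSIC and GEOMETRIC forms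

Cell `pub-hodgecm2` (COR-CM), seat b30 gen 20 (2026-08-22); count-neutral own lane OCTIC-WEIL-ORBIT, part MIXED — capstone of
`Census/OcticWeilMixed(Parts)` → `CorCM/OcticWeilMixedFrameTransfer` → `…SixfoldParts` → `…PowersHodgeOfMarkman`.  Theorems
only; no definition, no `sorry`; displayed named facts: `Markman2025_weilClasses_algebraic_abelianFourfold`,
`Markman2025_weilClasses_algebraic_hyperbolicSixfold` (both unrefereed).

THE STATEMENT (`hodgeConjectureFor_biproduct_comp_vec_of_isSimple_of_markmanM`).  `K` ANY CM field of degree `8`, `k`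
imaginary quadratic, `i : k → K`, `τ : k → ℂ`; `B₁ ⊨ (K; Φ₁)` SIMPLE and `B₂ ⊨ (K; Φ₂)` of `k`-signature `(2,2)` in general
position (`#{s ∈ Φ₁ ∩ Φ₂ | s ∘ i = τ} = 1`); `B' ⊨ (K; Φ')` of `k`-signature `(1,3)` (`#{s ∈ Φ' | s ∘ i = τ} = 1` — ANY such
type: primitive or not, `B'` simple or not); `E ⊨ (k; Ψ ∋ τ)`.  Then for every `κ : Fin N → Fin 4` every rational
`(q,q)`-class on `⨁_j ![E, B₁, B₂, B'] (κ j)` is algebraic, and so is every Hodge class on anything dominated by such a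
product.  This unites gen 18's OCTIC-EB (`E × B'`), gen 19's OCTIC-WEIL22 (`E × B₁`) and half of gen 20's ORBIT in one
product; the exact census shows it is the end of the road for this device (three `(2,2)`-types plus a `(1,3)`-type, or two
`(1,3)`-types, carry classes that are not disjoint unions of pairs / Weil `4`-sets / Weil `6`-sets).

THE PROOF.  `exists_frameM`: a frame in which `Φ₁, Φ₂` read as `I_0, I_1` up to conjugation (relabeling lemma for two
`2`-subsets meeting in a point, `decide`) and `Φ'` reads STRAIGHT as `Φ'_c`, `c` the label of its unique member over `τ`;
conjugate readings are absorbed by `OcticWeilOrbit.exists_realisation_of_reading`; `√−d ∈ 𝓞_k` with `τ(√−d) = i√d`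
(`CyclicSextic.exists_sq_eq_neg_nat_of_isTotallyComplex`, `OcticCurveFourfold.exists_delta_of_mem`); `2`-transitivity from the
simplicity of `B₁` (`OcticWeilFourfold.twoTransitive_of_isSimple`, Dodson); and the frame form
`hodgeConjectureFor_biproduct_comp_of_frameM_of_markman_h2t` at `Kf = (k, K)`.
HONEST FRAMING: conditional on the two displayed Markman binders; nothing here asserts `HC_CM`.

## References
* [Markman2025SurveySecant] E. Markman, arXiv:2509.23403, Thm. 1.2.  [Markman2025SecantWeil] E. Markman, arXiv:2502.03415,
  Thm 1.5.1.  [Dodson1984] B. Dodson, Trans. AMS 283 (1984), §3.3.2 Theorem.  [Deligne1982HodgeCycles] LNM 900 (1982),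
  §4 Prop. 4.4, §5 (b), (c).  [Shimura1998] G. Shimura, §8.2 Prop. 26, §18.2.  [Pohlmann1968] Ann. of Math. 88 (1968),
  Thm 1.  [MumfordAV1970] D. Mumford, *Abelian Varieties*, §19.
-/

noncomputable section

open CategoryTheory CategoryTheory.Limits NumberField

namespace Summit.HodgeConjecture.CorCM.OcticWeilMixed

open Literature.AlgebraicGeometry Literature.AlgebraicGeometry.Motives Literature.AlgebraicGeometry.HodgeTheory
open Literature.AlgebraicGeometry.ComplexMultiplication (IsCMTypeRealisation exists_conjugate_cmType
  mem_conjugate_cmType_iff_notMem)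
open Literature.AlgebraicGeometry.Pohlmann1968
open Literature.AlgebraicTopology.SingularHomology
open Literature.NumberTheory.ComplexMultiplication
open Summit.HodgeConjecture.CorCM.Census.OcticWeilOrbit (signTab permTab permTab_facts)
open Summit.HodgeConjecture.CorCM.Census.OcticWeilMixed (signTabM signTabM_two)
open Summit.HodgeConjecture.CorCM.OcticWeilOrbit (card_filter_symm_true mem_iff_of_reading_true
  exists_realisation_of_reading)
open Summit.HodgeConjecture.CorCM.OcticWeilFourfold (exists_frame₂ h2t_of_twoTransitive twoTransitive_of_isSimple)
open Summit.HodgeConjecture.CorCM.OcticCurveFourfold (exists_delta_of_mem card_filter_comp_eq_four)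

open scoped Classical

/-! ## §1 The frame for two `(2,2)`-types in general position and one `(1,3)`-type -/

section Frame

/-- **The relabeling lemma for two pairs**: two `2`-subsets `T₀, T₁` of `Fin 4` meeting in one point are put by a permutation
`σ` and flips `f₀, f₁` onto `I_0 = {0,1}`, `I_1 = {0,2}` (or their complements): `a ∈ T_m ⟺ [σ a ∈ I_m] = ¬f_m`. [folklore] -/
theorem exists_perm_flips_of_two_pairs : ∀ T₀ T₁ : Finset (Fin 4), T₀.card = 2 → T₁.card = 2 → (T₀ ∩ T₁).card = 1 →
    ∃ σ : Equiv.Perm (Fin 4), ∃ f : Fin 2 → Bool, ∀ a : Fin 4,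
      (a ∈ T₀ ↔ signTab 0 0 (σ a) = !f 0) ∧ (a ∈ T₁ ↔ signTab 0 1 (σ a) = !f 1) := by
  unfold signTab
  decide +kernel

variable {K : Type} [Field K] [NumberField K] [IsCMField K] {k : Type} [Field k] [NumberField k]

omit [NumberField K] [IsCMField K] in
/-- **Reading a `(1,3)`-type through a frame**: if `e s̄ = ((e s).1, ¬(e s).2)` and the unique member of `Φ'` over `τ` has
label `c` (`e⁻¹(a, true) ∈ Φ' ⟺ a = c`), then `s ∈ Φ' ⟺ (e s).2 = [(e s).1 = c]` — the straight reading of slot `2` of the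
mixed model (`signTabM c 0 2`). [cite: Deligne1982HodgeCycles, §5 (c)] -/
theorem mem_iff_of_single {e : (K →+* ℂ) ≃ Fin 4 × Bool}
    (he_conj : ∀ s, e (ComplexEmbedding.conjugate s) = ((e s).1, !(e s).2)) {Φ : CMType K} {c : Fin 4}
    (hc : ∀ a : Fin 4, e.symm (a, true) ∈ Φ.1 ↔ a = c) (s : K →+* ℂ) : s ∈ Φ.1 ↔ (e s).2 = signTabM c 0 2 (e s).1 := by
  rw [signTabM_two, permTab_facts.2.2]
  have key := hc (e s).1
  cases h2s : (e s).2
  · have hs : ComplexEmbedding.conjugate s = e.symm ((e s).1, true) := by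
      apply e.injective
      rw [he_conj, Equiv.apply_symm_apply, h2s]
      rfl
    rw [← hs] at key
    rw [Φ.2 s, key]
    change ¬ (e s).1 = c ↔ false = decide ((e s).1 = c)
    by_cases h : (e s).1 = c
    · rw [decide_eq_true h]; simp [h]
    · rw [decide_eq_false h]; simp [h]
  · have hs : s = e.symm ((e s).1, true) := by
      apply e.injective
      rw [Equiv.apply_symm_apply]
      exact Prod.ext rfl h2s
    rw [← hs] at key
    rw [key]
    change (e s).1 = c ↔ true = decide ((e s).1 = c)
    by_cases h : (e s).1 = c
    · rw [decide_eq_true h]; simp [h]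
    · rw [decide_eq_false h]; simp [h]

omit [IsCMField K] in
/-- **THE FRAME EXISTS (mixed).**  For `[K:ℚ] = 8`, `i : k → K`, `Hom(k, ℂ) = {τ, τ̄}`, two CM types `Φ₁, Φ₂` with two members
over `τ` each and exactly one in common, and a CM type `Φ'` with ONE member over `τ`: an enumeration `e` with
`(e s).2 = [s ∘ i = τ]`, `e s̄ = ((e s).1, ¬(e s).2)`, flips `f₀, f₁` and a label `c < 4` such that `Φ₁, Φ₂` read as `I_0, I_1`
up to the flips and `Φ'` reads straight as `Φ'_c`. [cite: Shimura1998, §18.2 Lemma] [cite: Dodson1984, §3.1.1] -/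
theorem exists_frameM (h8 : Module.finrank ℚ K = 8) (h2 : Module.finrank ℚ k = 2) (i : k →+* K) {τ : k →+* ℂ}
    (hττ : ComplexEmbedding.conjugate τ ≠ τ) (hk : ∀ σ : k →+* ℂ, σ = τ ∨ σ = ComplexEmbedding.conjugate τ)
    (Φ₁ Φ₂ Φ' : CMType K)
    (h22₁ : (Finset.univ.filter fun s : K →+* ℂ => s.comp i = τ ∧ s ∈ Φ₁.1).card = 2)
    (h22₂ : (Finset.univ.filter fun s : K →+* ℂ => s.comp i = τ ∧ s ∈ Φ₂.1).card = 2)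
    (h₁₂ : (Finset.univ.filter fun s : K →+* ℂ => s.comp i = τ ∧ (s ∈ Φ₁.1 ∧ s ∈ Φ₂.1)).card = 1)
    (h13 : (Finset.univ.filter fun s : K →+* ℂ => s.comp i = τ ∧ s ∈ Φ'.1).card = 1) :
    ∃ (e : (K →+* ℂ) ≃ Fin 4 × Bool) (f : Fin 2 → Bool) (c : Fin 4), (∀ s, (e s).2 = true ↔ s.comp i = τ) ∧
      (∀ s, e (ComplexEmbedding.conjugate s) = ((e s).1, !(e s).2)) ∧
      (∀ s, s ∈ Φ₁.1 ↔ signTab 0 0 (e s).1 = ((e s).2 != f 0)) ∧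
      (∀ s, s ∈ Φ₂.1 ↔ signTab 0 1 (e s).1 = ((e s).2 != f 1)) ∧
      (∀ s, s ∈ Φ'.1 ↔ (e s).2 = signTabM c 0 2 (e s).1) := by
  obtain ⟨e₀, he₀_sign, he₀_conj, -⟩ := exists_frame₂ h8 h2 i hττ hk Φ₁ h22₁
  set T₀ : Finset (Fin 4) := Finset.univ.filter fun a => e₀.symm (a, true) ∈ Φ₁.1 with hT₀
  set T₁ : Finset (Fin 4) := Finset.univ.filter fun a => e₀.symm (a, true) ∈ Φ₂.1 with hT₁
  have hinter : T₀ ∩ T₁ = Finset.univ.filter fun a : Fin 4 => e₀.symm (a, true) ∈ Φ₁.1 ∧ e₀.symm (a, true) ∈ Φ₂.1 :=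
    (Finset.filter_and _ _ _).symm
  obtain ⟨σ, f, hσ⟩ := exists_perm_flips_of_two_pairs T₀ T₁
    (by rw [hT₀, card_filter_symm_true he₀_sign (fun s => s ∈ Φ₁.1)]; exact h22₁)
    (by rw [hT₁, card_filter_symm_true he₀_sign (fun s => s ∈ Φ₂.1)]; exact h22₂)
    (by rw [hinter, card_filter_symm_true he₀_sign (fun s => s ∈ Φ₁.1 ∧ s ∈ Φ₂.1)]; exact h₁₂)
  -- the unique `τ`-member of `Φ'` and its label
  obtain ⟨a₀, ha₀⟩ := Finset.card_eq_one.1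
    (show (Finset.univ.filter fun a : Fin 4 => e₀.symm (a, true) ∈ Φ'.1).card = 1 by
      rw [card_filter_symm_true he₀_sign (fun s => s ∈ Φ'.1)]; exact h13)
  have ha₀' : ∀ a : Fin 4, e₀.symm (a, true) ∈ Φ'.1 ↔ a = a₀ := fun a => by
    have h : a ∈ (Finset.univ.filter fun a : Fin 4 => e₀.symm (a, true) ∈ Φ'.1) ↔ a ∈ ({a₀} : Finset (Fin 4)) := by
      rw [ha₀]
    simpa using h
  -- the re-numbered frame
  let e : (K →+* ℂ) ≃ Fin 4 × Bool := e₀.trans (Equiv.prodCongr σ (Equiv.refl Bool))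
  have he : ∀ s, e s = (σ (e₀ s).1, (e₀ s).2) := fun s => rfl
  have he_conj : ∀ s, e (ComplexEmbedding.conjugate s) = ((e s).1, !(e s).2) := fun s => by rw [he, he, he₀_conj]
  have hsymm : ∀ b : Fin 4, e.symm (b, true) = e₀.symm (σ.symm b, true) := fun b => rfl
  have hread : ∀ (Φ : CMType K) (m : Fin 3) (fm : Bool),
      (∀ a : Fin 4, e₀.symm (a, true) ∈ Φ.1 ↔ signTab 0 m (σ a) = !fm) →
      ∀ s, s ∈ Φ.1 ↔ signTab 0 m (e s).1 = ((e s).2 != fm) := by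
    intro Φ m fm hm
    refine mem_iff_of_reading_true he_conj fun b => ?_
    rw [hsymm, hm (σ.symm b), Equiv.apply_symm_apply]
  refine ⟨e, f, σ a₀, fun s => by rw [he]; exact he₀_sign s, he_conj,
    hread Φ₁ 0 (f 0) fun a => by rw [← (hσ a).1, hT₀]; simp,
    hread Φ₂ 1 (f 1) fun a => by rw [← (hσ a).2, hT₁]; simp,
    mem_iff_of_single he_conj fun b => ?_⟩
  rw [hsymm, ha₀' (σ.symm b), Equiv.symm_apply_eq]

end Frame

/-! ## §2 The intrinsic theorem (under `2`-transitivity) and the geometric theorem (`B₁` simple) -/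

section Main

variable {K : Type} [Field K] [NumberField K] [IsCMField K] {k : Type} [Field k] [NumberField k] [IsCMField k] {N : ℕ}
  {Φ₁ Φ₂ Φ' : CMType K} {B₁ B₂ B' : AbelianVariety ℂ}
  {ι₁ : 𝓞 K →+* End B₁} {θ₁ : K →+* Module.End ℂ (complexBetti B₁.X 1)}
  {ι₂ : 𝓞 K →+* End B₂} {θ₂ : K →+* Module.End ℂ (complexBetti B₂.X 1)}
  {ι' : 𝓞 K →+* End B'} {θ' : K →+* Module.End ℂ (complexBetti B'.X 1)}
  {Ψ : CMType k} {E : AbelianVariety ℂ} {ιE : 𝓞 k →+* End E} {θE : k →+* Module.End ℂ (complexBetti E.X 1)}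

/-- **THE HODGE CONJECTURE FOR EVERY PRODUCT OF COPIES OF `E, B₁, B₂, B'`, GIVEN ONLY Markman's fourfold and sixfold
theorems** — `B₁, B₂ ⊨ (K; Φ₁), (K; Φ₂)` CM abelian fourfolds of `k`-signature `(2,2)` in general position, `B' ⊨ (K; Φ')` of
`k`-signature `(1,3)`, `E ⊨ (k; Ψ ∋ τ)`, all over ONE CM field `K` of degree `8`, and `Aut(ℂ)` `2`-TRANSITIVE on the four
embeddings of `K` over `τ` (`h2T`; Dodson: automatic when `B₁` is simple): for every `κ : Fin N → Fin 4`, every rational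
`(q,q)`-class on `⨁_j ![E, B₁, B₂, B'] (κ j)` is algebraic. [cite: Markman2025SurveySecant, Thm. 1.2]
[cite: Markman2025SecantWeil, Thm 1.5.1] [cite: Pohlmann1968, Thm 1] [cite: Dodson1984, §3.3.2 Theorem]
[cite: Deligne1982HodgeCycles, §5 (b), (c)] -/
theorem hodgeConjectureFor_biproduct_comp_vec_of_markmanM
    (hW4 : Markman2025_weilClasses_algebraic_abelianFourfold) (hM6 : Markman2025_weilClasses_algebraic_hyperbolicSixfold)
    (h8 : Module.finrank ℚ K = 8) (h2 : Module.finrank ℚ k = 2) (i : k →+* K)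
    (hB₁ : IsCMTypeRealisation Φ₁ B₁ ι₁ θ₁) (hB₂ : IsCMTypeRealisation Φ₂ B₂ ι₂ θ₂)
    (hB' : IsCMTypeRealisation Φ' B' ι' θ') (hE : IsCMTypeRealisation Ψ E ιE θE)
    {τ : k →+* ℂ} (hτΨ : τ ∈ Ψ.1)
    (h22₁ : (Finset.univ.filter fun s : K →+* ℂ => s.comp i = τ ∧ s ∈ Φ₁.1).card = 2)
    (h22₂ : (Finset.univ.filter fun s : K →+* ℂ => s.comp i = τ ∧ s ∈ Φ₂.1).card = 2)
    (h₁₂ : (Finset.univ.filter fun s : K →+* ℂ => s.comp i = τ ∧ (s ∈ Φ₁.1 ∧ s ∈ Φ₂.1)).card = 1)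
    (h13 : (Finset.univ.filter fun s : K →+* ℂ => s.comp i = τ ∧ s ∈ Φ'.1).card = 1)
    (h2T : ∀ s t s' t' : K →+* ℂ, s.comp i = τ → t.comp i = τ → s'.comp i = τ → t'.comp i = τ → s ≠ t → s' ≠ t' →
      ∃ ρ : ℂ ≃+* ℂ, (ρ : ℂ →+* ℂ).comp s = s' ∧ (ρ : ℂ →+* ℂ).comp t = t')
    (κ : Fin N → Fin 4) :
    HodgeConjectureFor (⨁ fun j => (![E, B₁, B₂, B'] : Fin 4 → AbelianVariety ℂ) (κ j)).dim
      (⨁ fun j => (![E, B₁, B₂, B'] : Fin 4 → AbelianVariety ℂ) (κ j)).X := by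
  have hττ : ComplexEmbedding.conjugate τ ≠ τ := QuarticCM.conjugate_ne τ
  have hk : ∀ σ : k →+* ℂ, σ = τ ∨ σ = ComplexEmbedding.conjugate τ := fun σ =>
    QuarticCM.eq_or_eq_conjugate_of_quadratic h2 τ σ
  have hΨ : ∀ σ : k →+* ℂ, σ ∈ Ψ.1 ↔ σ = τ := by
    intro σ
    rcases hk σ with rfl | rfl
    · exact ⟨fun _ => rfl, fun _ => hτΨ⟩
    · exact ⟨fun h => absurd h ((Ψ.2 τ).1 hτΨ), fun h => absurd h hττ⟩
  -- `√−d ∈ 𝓞_k` with `τ(√−d) = i√d`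
  obtain ⟨δ₀, d, hd, hδ₀⟩ := CyclicSextic.exists_sq_eq_neg_nat_of_isTotallyComplex k h2
  obtain ⟨δ, hδ, hτ⟩ := exists_delta_of_mem h2 hd hδ₀ τ
  -- the frame, and the straight readings after passing to conjugate structures where needed
  obtain ⟨e, f, c, he_sign, he_conj, hr₁, hr₂, hr'⟩ := exists_frameM h8 h2 i hττ hk Φ₁ Φ₂ Φ' h22₁ h22₂ h₁₂ h13
  obtain ⟨Φ₁', ι₁', θ₁', hB₁', hΦ₁'⟩ := exists_realisation_of_reading he_conj hr₁ hB₁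
  obtain ⟨Φ₂', ι₂', θ₂', hB₂', hΦ₂'⟩ := exists_realisation_of_reading he_conj hr₂ hB₂
  have hΦ₁M : ∀ s, s ∈ Φ₁'.1 ↔ (e s).2 = signTabM c 0 0 (e s).1 := fun s => by
    rw [hΦ₁', signTabM_zero_of_ne_two (by decide)]
  have hΦ₂M : ∀ s, s ∈ Φ₂'.1 ↔ (e s).2 = signTabM c 0 1 (e s).1 := fun s => by
    rw [hΦ₂', signTabM_zero_of_ne_two (by decide)]
  have h2t := h2t_of_twoTransitive he_sign h2T
  -- the family `Kf = (k, K)` and the four slots `(k, K, K, K)`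
  let Kf : Fin 2 → Type := Fin.cons k fun _ : Fin 1 => K
  letI instF : ∀ j, Field (Kf j) := fun j =>
    Fin.cases (motive := fun j => Field (Kf j)) ‹Field k› (fun _ => ‹Field K›) j
  letI instN : ∀ j, NumberField (Kf j) := fun j =>
    Fin.cases (motive := fun j => NumberField (Kf j)) ‹NumberField k› (fun _ => ‹NumberField K›) j
  haveI instC : ∀ j, IsCMField (Kf j) := fun j =>
    Fin.cases (motive := fun j => IsCMField (Kf j)) ‹IsCMField k› (fun _ => ‹IsCMField K›) j
  exact hodgeConjectureFor_biproduct_comp_of_frameM_of_markman_h2t (Kf := Kf) (i₀ := 0) (i₁ := 1)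
    (A₄ := ![E, B₁, B₂, B'])
    (Φ₄ := Fin.cons Ψ (Fin.cons Φ₁' (Fin.cons Φ₂' (Fin.cons Φ' finZeroElim))))
    (ι₄ := Fin.cons ιE (Fin.cons ι₁' (Fin.cons ι₂' (Fin.cons ι' finZeroElim))))
    (θ₄ := Fin.cons θE (Fin.cons θ₁' (Fin.cons θ₂' (Fin.cons θ' finZeroElim)))) hW4 hM6 κ h8 h2 i hd hδ hτ
    (Fin.cases hE (Fin.cases hB₁' (Fin.cases hB₂' (Fin.cases hB' fun l => l.elim0)))) e he_sign he_conj
    (Fin.cases hΦ₁M (Fin.cases hΦ₂M (Fin.cases hr' fun l => l.elim0))) hΨ h2t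

/-- **THE GEOMETRIC FORM: `B₁` SIMPLE.**  For a SIMPLE CM abelian fourfold `B₁ ⊨ (K; Φ₁)` of `k`-signature `(2,2)` (a
DEGENERATE simple CM fourfold; Dodson: `Gal(Kᶜ/ℚ) ≅ ℤ₂ × A₄` or `ℤ₂ × S₄`), a second realisation `B₂ ⊨ (K; Φ₂)` of a
`(2,2)`-type in general position with `Φ₁` (e.g. a Galois conjugate `σB₁` of another type class), ANY CM fourfold `B' ⊨ (K; Φ')`
of `k`-signature `(1,3)` (e.g. any simple CM fourfold of the same `K` that is NOT of Weil type for `k`), and the CM curve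
`E ⊨ (k; Ψ ∋ τ)`: the Hodge conjecture for EVERY product of copies of `E, B₁, B₂, B'`, GIVEN ONLY Markman's fourfold and
hyperbolic-sixfold theorems. [cite: Markman2025SurveySecant, Thm. 1.2] [cite: Markman2025SecantWeil, Thm 1.5.1]
[cite: Dodson1984, §3.3.2 Theorem] [cite: Shimura1998, §8.2 Prop. 26] [cite: Pohlmann1968, Thm 1 and §3] -/
theorem hodgeConjectureFor_biproduct_comp_vec_of_isSimple_of_markmanM
    (hW4 : Markman2025_weilClasses_algebraic_abelianFourfold) (hM6 : Markman2025_weilClasses_algebraic_hyperbolicSixfold)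
    (h8 : Module.finrank ℚ K = 8) (h2 : Module.finrank ℚ k = 2) (i : k →+* K)
    (hB₁ : IsCMTypeRealisation Φ₁ B₁ ι₁ θ₁) (hS : B₁.IsSimple) (hB₂ : IsCMTypeRealisation Φ₂ B₂ ι₂ θ₂)
    (hB' : IsCMTypeRealisation Φ' B' ι' θ') (hE : IsCMTypeRealisation Ψ E ιE θE)
    {τ : k →+* ℂ} (hτΨ : τ ∈ Ψ.1)
    (h22₁ : (Finset.univ.filter fun s : K →+* ℂ => s.comp i = τ ∧ s ∈ Φ₁.1).card = 2)
    (h22₂ : (Finset.univ.filter fun s : K →+* ℂ => s.comp i = τ ∧ s ∈ Φ₂.1).card = 2)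
    (h₁₂ : (Finset.univ.filter fun s : K →+* ℂ => s.comp i = τ ∧ (s ∈ Φ₁.1 ∧ s ∈ Φ₂.1)).card = 1)
    (h13 : (Finset.univ.filter fun s : K →+* ℂ => s.comp i = τ ∧ s ∈ Φ'.1).card = 1)
    (κ : Fin N → Fin 4) :
    HodgeConjectureFor (⨁ fun j => (![E, B₁, B₂, B'] : Fin 4 → AbelianVariety ℂ) (κ j)).dim
      (⨁ fun j => (![E, B₁, B₂, B'] : Fin 4 → AbelianVariety ℂ) (κ j)).X :=
  hodgeConjectureFor_biproduct_comp_vec_of_markmanM hW4 hM6 h8 h2 i hB₁ hB₂ hB' hE hτΨ h22₁ h22₂ h₁₂ h13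
    (twoTransitive_of_isSimple h8 h2 i hB₁ hS τ h22₁) κ

/-- **The `(3,1)` companion**: if `Φ'` has THREE members over `τ` (`k`-signature `(3,1)`), pass to the conjugate CM structure
`(B', ι' ∘ 𝓞(c), θ' ∘ c) ⊨ Φ̄'` (Deligne 1982 §5 (b); tree `IsCMTypeRealisation.comp_complexConj`), which has ONE member over `τ`.
[cite: Deligne1982HodgeCycles, §5 (b)] [cite: Markman2025SurveySecant, Thm. 1.2] [cite: Markman2025SecantWeil, Thm 1.5.1] -/
theorem hodgeConjectureFor_biproduct_comp_vec_of_isSimple_of_markmanM_of_card_eq_three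
    (hW4 : Markman2025_weilClasses_algebraic_abelianFourfold) (hM6 : Markman2025_weilClasses_algebraic_hyperbolicSixfold)
    (h8 : Module.finrank ℚ K = 8) (h2 : Module.finrank ℚ k = 2) (i : k →+* K)
    (hB₁ : IsCMTypeRealisation Φ₁ B₁ ι₁ θ₁) (hS : B₁.IsSimple) (hB₂ : IsCMTypeRealisation Φ₂ B₂ ι₂ θ₂)
    (hB' : IsCMTypeRealisation Φ' B' ι' θ') (hE : IsCMTypeRealisation Ψ E ιE θE)
    {τ : k →+* ℂ} (hτΨ : τ ∈ Ψ.1)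
    (h22₁ : (Finset.univ.filter fun s : K →+* ℂ => s.comp i = τ ∧ s ∈ Φ₁.1).card = 2)
    (h22₂ : (Finset.univ.filter fun s : K →+* ℂ => s.comp i = τ ∧ s ∈ Φ₂.1).card = 2)
    (h₁₂ : (Finset.univ.filter fun s : K →+* ℂ => s.comp i = τ ∧ (s ∈ Φ₁.1 ∧ s ∈ Φ₂.1)).card = 1)
    (h31 : (Finset.univ.filter fun s : K →+* ℂ => s.comp i = τ ∧ s ∈ Φ'.1).card = 3)
    (κ : Fin N → Fin 4) :
    HodgeConjectureFor (⨁ fun j => (![E, B₁, B₂, B'] : Fin 4 → AbelianVariety ℂ) (κ j)).dim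
      (⨁ fun j => (![E, B₁, B₂, B'] : Fin 4 → AbelianVariety ℂ) (κ j)).X := by
  obtain ⟨Φ'', hΦ''⟩ := exists_conjugate_cmType Φ'
  have h13 : (Finset.univ.filter fun s : K →+* ℂ => s.comp i = τ ∧ s ∈ Φ''.1).card = 1 := by
    have h4 := card_filter_comp_eq_four i h8 h2 τ
    have hsplit := Finset.card_filter_add_card_filter_not
      (s := Finset.univ.filter fun s : K →+* ℂ => s.comp i = τ) (fun s => s ∈ Φ'.1)
    rw [Finset.filter_filter, Finset.filter_filter, h4, h31] at hsplit
    rw [Finset.filter_congr fun s _ => show (s.comp i = τ ∧ s ∈ Φ''.1) ↔ (s.comp i = τ ∧ s ∉ Φ'.1) by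
      rw [mem_conjugate_cmType_iff_notMem hΦ'']]
    omega
  exact hodgeConjectureFor_biproduct_comp_vec_of_isSimple_of_markmanM hW4 hM6 h8 h2 i hB₁ hS hB₂ (hB'.comp_complexConj hΦ'')
    hE hτΨ h22₁ h22₂ h₁₂ h13 κ

/-- **… and for every abelian variety dominated by such a product** (isogeny factors, quotients, abelian subvarieties of some
`E^a × B₁^{n₁} × B₂^{n₂} × B'^{n'}`). [cite: Markman2025SurveySecant, Thm. 1.2] [cite: Markman2025SecantWeil, Thm 1.5.1] [cite: MumfordAV1970, §19] -/
theorem hodgeConjectureFor_of_avDominatedBy_comp_vec_of_isSimple_of_markmanM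
    (hW4 : Markman2025_weilClasses_algebraic_abelianFourfold) (hM6 : Markman2025_weilClasses_algebraic_hyperbolicSixfold)
    (h8 : Module.finrank ℚ K = 8) (h2 : Module.finrank ℚ k = 2) (i : k →+* K)
    (hB₁ : IsCMTypeRealisation Φ₁ B₁ ι₁ θ₁) (hS : B₁.IsSimple) (hB₂ : IsCMTypeRealisation Φ₂ B₂ ι₂ θ₂)
    (hB' : IsCMTypeRealisation Φ' B' ι' θ') (hE : IsCMTypeRealisation Ψ E ιE θE)
    {τ : k →+* ℂ} (hτΨ : τ ∈ Ψ.1)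
    (h22₁ : (Finset.univ.filter fun s : K →+* ℂ => s.comp i = τ ∧ s ∈ Φ₁.1).card = 2)
    (h22₂ : (Finset.univ.filter fun s : K →+* ℂ => s.comp i = τ ∧ s ∈ Φ₂.1).card = 2)
    (h₁₂ : (Finset.univ.filter fun s : K →+* ℂ => s.comp i = τ ∧ (s ∈ Φ₁.1 ∧ s ∈ Φ₂.1)).card = 1)
    (h13 : (Finset.univ.filter fun s : K →+* ℂ => s.comp i = τ ∧ s ∈ Φ'.1).card = 1)
    (κ : Fin N → Fin 4) {C : AbelianVariety ℂ}
    (hC : Domination.AVDominatedBy C (⨁ fun j => (![E, B₁, B₂, B'] : Fin 4 → AbelianVariety ℂ) (κ j))) :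
    HodgeConjectureFor C.dim C.X :=
  Domination.hodgeConjectureFor_of_avDominatedBy
    (hodgeConjectureFor_biproduct_comp_vec_of_isSimple_of_markmanM hW4 hM6 h8 h2 i hB₁ hS hB₂ hB' hE hτΨ h22₁ h22₂ h₁₂
      h13 κ) hC

end Main

end Summit.HodgeConjecture.CorCM.OcticWeilMixed

end
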